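import Literature.MathematicalPhysics.QuantumFieldTheory.Balaban1983to89.Node00.BgAveragingOfRecord
import Literature.MathematicalPhysics.QuantumFieldTheory.Balaban1983to89.Node00.LinearisedAveragingFlat
import Summits.QuantumFields.YangMills.Theorems.UnitScaleTiltProp7LinAvgOnto
import Summits.QuantumFields.YangMills.Theorems.UnitScaleTiltProp8ChartHInvComb
import Summits.QuantumFields.YangMills.Theorems.UnitScaleTiltProp7PinnedSkewSplit
import HarnessLib

/-!
# NODE N07 ([15] = [Balaban1985Variational]) — THE RECORD'S LINEARISED `k`-FOLD AVERAGING `Q = Q_k(U₀)` OF ✓p814239 `Node00/BgAveragingOfRecord` IS ONTO AT THE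
# FLAT BACKGROUND `U₀ = 1`: a DISCHARGE of the displayed hypothesis `hQ : Function.Surjective (QOfRecord F N k U₀)` of `Node00.frakGOfRecordAtBg` ∕ `H1OfRecordAtBg`
# at `U₀ = 1`, `k ≤ m + K`

Cell `pub-ymgap`, width seat `pub-ymgap-dag-n07-w3` (g24), CLAIM-1 (bus 2026-08-31 ≈07:13Z).  `--kind proof --supports stmt-QuantumFields-27238 --as helper`;
count-neutral.  [15] = [Balaban1985Variational]; [B9] = [Balaban1985BackgroundPropagators]; [B7] = [Balaban1985Averaging].

WHY.  The custodian's M1 file 3b (node00-def-Y g36, ✓p814239) pins print's averaging letters `Q(U₀)`, `Q′(U₀)` of [B9] (3.13)–(3.19) at the record and leaves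
TWO displayed proofs in the `𝒢`-slot `frakGOfRecordAtBg F N K k Ω U₀ a hpos hQ`: `hpos` ([B9] Thm 3.11 at the record) and `hQ : Function.Surjective (QOfRecord F N k U₀)`
(«`Q(U₀)` onto, so that `QG₁Q*` of [15] (103)∕(111) is invertible»; def-Y's E1 word: «NOT a theorem of the tree today; roads: flat `U₀ = 1` via n07-w1's
`dAvgL 1 = linAvg` sequel + far-face lift, general small `U₀` by [B7] Sect. E — a prover target»).  THIS FILE takes the flat road to its end.

THE PROOF (linear algebra over kernel-checked tree identities; nothing of Bałaban's analysis is used or asserted).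
`QOfRecord F N k U₀ = bondFieldOut ∘ qCplxOp k U₀ ∘ bondFieldIn` (def-Y), the outer two being read-in∕read-out through EQUIVALENCES (`bondToLit`, `phiRec`,
`WL2.linearEquiv`) — hence onto (§3); `qCplxOp k U₀ = cplxOp (qSkewOp k U₀)` is def-Y's canonical complexification `T^ℂ Y = T(𝔞Y) + i·T(𝔞(−iY))` from the real
form `𝔲(N)`, which is onto AS SOON AS every skew-Hermitian level-`k` field has a skew-Hermitian `T`-preimage (§1 `cplxOp_surjective_of_skew`, by
`skewField_decomp`); at `U₀ = 1`, `qSkewOp k 1 Y = L^{-k}·(Q_k(1)Y)` (`Ū^k(1) = 1`, `1⋆ = 1`; §2 `qSkewOp_one_apply`) and on skew `Y` n07-w1's ★★★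
`Node00.dIterL_one_apply_of_skew` identifies `Q_k(1)Y` with UST's `linAvg` recursion `Q^{(k)}Y` (`Q^{(0)} = id`, `Q^{(j+1)} = linAvg ∘ Q^{(j)}`,
`ChartHInv.exists_linFamily`); `Q^{(k)}` is onto for `k ≤ m + K` by induction on UST's one-step far-face right inverse (`Prop7LinAvgOnto.linAvg_surjective`,
§2 `linFamily_surjective`), and a skew target has a SKEW preimage — the skew part `½(Y′ − Y′ᴴ)` of any preimage `Y′`, because `Q^{(k)}` commutes with `ᴴ`
(`Prop7PinnedSkewSplit.iterQ_sub_conjTranspose`; §2 `exists_skew_linFamily_eq`).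

WHAT IS PROVED (sorry-free; no definition; axioms standard).
* §1 (generic real-linear `T`, def-Y's §1 letters) ★ `skewField_conjTranspose` (`𝔞Y` is skew), ★★ `cplxOp_surjective_of_skew`.
* §2 (generic `P`, `M_N(ℂ)`-valued fields) ★ `linFamily_surjective` (`k ≤ m + K`), ★★ `exists_skew_linFamily_eq`, ★ `qSkewOp_one_apply` (every `Y`),
  ★★ `exists_skew_qSkewOp_one_eq` (every skew level-`k` field is `qSkewOp k 1` of a skew fine field), ★★★ `qCplxOp_one_surjective`.
* §3 (the record `F : T4Family`) ★ `bondFieldIn_surjective`, ★ `bondFieldOut_surjective`, ★★ `QOfRecord_surjective_of_qCplxOp` ∕ ★★ `QOfRecord_surjective_of_skew` (ANY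
  background: `QOfRecord F N k U₀` is onto as soon as `qCplxOp k U₀` is ∕ as soon as every skew level-`k` field is `qSkewOp k U₀` of a skew fine field), ★★★ `QOfRecord_one_surjective (hk : k ≤ F.m + K) : Function.Surjective (QOfRecord F N k 1)` — the `hQ` slot of
  `frakGOfRecordAtBg F N K k Ω 1 …` ∕ `H1OfRecordAtBg … 1 …` DISCHARGED.

HONEST SCOPE.  FLAT background only: the record's P0 pins `𝔊(U₀)` at the small-field background `U₀` of record (`UkSel` ∕ `bgOfRecord`), NOT at `1`; there `hQ` is the
submersion property of `U ↦ Ū^k(U)` at a guarded background ([B7] Sect. E) and stays DISPLAYED — §1 and `QOfRecord_surjective_of_qCplxOp` reduce it, for every `U₀`, to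
«every skew level-`k` field is `qSkewOp k U₀` of a skew fine field».  `hpos` untouched.  Nothing of [B9]∕[15]∕[B7] asserted; no estimate; P0 OPEN; N07 NOT discharged;
K0ᴬ∕K1ᴬ∕K3ᴬ OPEN; counts unmoved (28∕28 · 8∕28 · K 1∕4); one finite 𝕋⁴ programme at fixed ε — R4 closes the conditional finite-𝕋⁴ rung `BalabanLadder.UV` only,
never the summit; nothing continuum ∕ ℝ⁴ ∕ OS; the Yang–Mills mass gap (Clay) is NOT proved by any of this.  No `sorry`, no `def`, no `instance`, no `notation`.

References: [B9] (3.13)–(3.16) p.393, Thm 3.11 p.416; [15] (44)–(47) p.285, (100)∕(103) p.293, (110)–(111) p.294, (116)–(117) p.295; [B7] (62) p.28, Prop. 3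
(124)–(125) p.36, Sect. E pp.40–45; [Balaban1987RG1] (0.4) p.253, (0.21) p.256.
-/

set_option autoImplicit false

noncomputable section

open scoped Matrix

namespace Summit.QuantumFields.YangMills.Theorems.N07QOfRecordFlatOnto

open Literature.MathematicalPhysics.QuantumFieldTheory.Balaban1983to89
open Literature.MathematicalPhysics.QuantumFieldTheory.Balaban1983to89.T4Continuum (T4Family)
open T4Continuum BlockAveraging
open BlockAveragingEMLLinearised (linAvg)
open B9Eq311L2Pairing (WL2)
open Node00
open Summit.QuantumFields.YangMills.Theorems.Prop7LinAvgOnto (linAvg_surjective)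
open Summit.QuantumFields.YangMills.Theorems.ChartHInv (exists_linFamily linFamily_const_smul)
open Summit.QuantumFields.YangMills.Theorems.Prop7PinnedSkewSplit (iterQ_sub_conjTranspose)

/-! ## §1  The complexification `T^ℂ` of a real-linear `T` is onto as soon as skew targets have skew `T`-preimages -/

section Complexify

variable {ι κ n : Type*}

/-- ★ The skew part `𝔞Y = ½(Y − Yᴴ)` is skew-Hermitian, bondwise. [cite: Balaban1985BackgroundPropagators, (3.1) p.390, p.393] -/
theorem skewField_conjTranspose (Y : ι → Matrix n n ℂ) (b : ι) : (skewField Y b)ᴴ = -skewField Y b := by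
  have h2 : star (2⁻¹ : ℂ) = 2⁻¹ := by simp
  rw [skewField_apply, Matrix.conjTranspose_smul, Matrix.conjTranspose_sub, Matrix.conjTranspose_conjTranspose, h2, ← smul_neg, neg_sub]

/-- ★★ **`T^ℂ` IS ONTO AS SOON AS EVERY SKEW-HERMITIAN TARGET HAS A SKEW-HERMITIAN `T`-PREIMAGE.**  For def-Y's canonical complexification
`T^ℂ Y = T(𝔞Y) + i·T(𝔞(−iY))` ([Balaban1985BackgroundPropagators] p.393): given `Z`, decompose `Z = 𝔞Z + i·𝔞(−iZ)` (`skewField_decomp`), pick skew `Y₁`, `Y₂` with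
`T Y₁ = 𝔞Z`, `T Y₂ = 𝔞(−iZ)`; then `Y := Y₁ + iY₂` has `𝔞Y = Y₁`, `𝔞(−iY) = Y₂`, so `T^ℂ Y = Z`. [cite: Balaban1985BackgroundPropagators, (3.13) p.393; Balaban1985Variational, (45) p.285] -/
theorem cplxOp_surjective_of_skew (T : (ι → Matrix n n ℂ) →ₗ[ℝ] (κ → Matrix n n ℂ))
    (h : ∀ Z : κ → Matrix n n ℂ, (∀ c, (Z c)ᴴ = -Z c) → ∃ Y : ι → Matrix n n ℂ, (∀ b, (Y b)ᴴ = -Y b) ∧ T Y = Z) :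
    Function.Surjective (cplxOp T) := by
  intro Z
  obtain ⟨Y₁, hY₁, hT₁⟩ := h (skewField Z) (skewField_conjTranspose Z)
  obtain ⟨Y₂, hY₂, hT₂⟩ := h (skewField (-Complex.I • Z)) (skewField_conjTranspose _)
  refine ⟨Y₁ + Complex.I • Y₂, ?_⟩
  have hherm : ∀ b, ((Complex.I • Y₂) b)ᴴ = (Complex.I • Y₂) b := fun b => by
    rw [Pi.smul_apply, Matrix.conjTranspose_smul, hY₂ b, Complex.star_def, Complex.conj_I, neg_smul_neg]
  have h1 : skewField (Y₁ + Complex.I • Y₂) = Y₁ := by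
    rw [skewField_add, skewField_of_skew hY₁, skewField_of_herm hherm, add_zero]
  have h2 : skewField (-Complex.I • (Y₁ + Complex.I • Y₂)) = Y₂ := by
    rw [smul_add, skewField_add, skewField_negI_smul_of_skew hY₁, zero_add, smul_smul, neg_mul, Complex.I_mul_I, neg_neg, one_smul,
      skewField_of_skew hY₂]
  rw [cplxOp_apply, h1, h2, hT₁, hT₂, skewField_decomp]

end Complexify

/-! ## §2  Generic lattice `P`: UST's `linAvg` recursion is onto with skew preimages of skew targets; `qSkewOp k 1`; `qCplxOp k 1` onto -/

section Lattice

variable {P : Params} {N : ℕ}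

variable (Q : (i : ℕ) → (PBond P 0 → Matrix (Fin N) (Fin N) ℂ) → PBond P i → Matrix (Fin N) (Fin N) ℂ)
  (hQ0 : ∀ Y, Q 0 Y = Y)
  (hQs : ∀ (i : ℕ) (Y : PBond P 0 → Matrix (Fin N) (Fin N) ℂ) (c : PBond P (i + 1)), Q (i + 1) Y c = linAvg (Q i Y) c)

include hQ0 hQs in
/-- ★ **UST's `linAvg` RECURSION `Q^{(k)}` IS ONTO for `k ≤ m + K`** (induction on the one-step far-face right inverse `Prop7LinAvgOnto.linAvg_surjective`; only
ontoness is used below — a `k`-uniform, `𝔰𝔲`-preserving right inverse WITH LETTER is dag-n10-w1's ✓`N12FlatLinFamilyRightInverseUniform.exists_linFamily_rightInverse_uniform`).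
[cite: Balaban1985Variational, (45) p.285; Balaban1985Averaging, (124)-(125) p.36] -/
theorem linFamily_surjective {k : ℕ} (hk : k ≤ P.m + P.K) : Function.Surjective (Q k) := by
  induction k with
  | zero => exact fun Z => ⟨Z, hQ0 Z⟩
  | succ k ih =>
    intro Z
    obtain ⟨W, hW⟩ := linAvg_surjective (n := Fin N) hk Z
    obtain ⟨Y, hY⟩ := ih (Nat.le_of_succ_le hk) W
    refine ⟨Y, funext fun c => ?_⟩
    rw [hQs, hY]
    exact congrFun hW c

include hQ0 hQs in
/-- ★★ **SKEW TARGETS HAVE SKEW PREIMAGES UNDER `Q^{(k)}`** (`k ≤ m + K`): the skew part `½(Y′ − Y′ᴴ)` of any preimage `Y′` of a skew `Z` is again a preimage,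
because `Q^{(k)}` is `ℂ`-linear and commutes with `ᴴ` (`ChartHInv.linFamily_const_smul`, `Prop7PinnedSkewSplit.iterQ_sub_conjTranspose`).
[cite: Balaban1985Variational, (44)-(45) p.285; Balaban1985Averaging, (124)-(125) p.36] -/
theorem exists_skew_linFamily_eq {k : ℕ} (hk : k ≤ P.m + P.K) {Z : PBond P k → Matrix (Fin N) (Fin N) ℂ} (hZ : ∀ c, (Z c)ᴴ = -Z c) :
    ∃ Y : PBond P 0 → Matrix (Fin N) (Fin N) ℂ, (∀ b, (Y b)ᴴ = -Y b) ∧ Q k Y = Z := by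
  obtain ⟨Y', hY'⟩ := linFamily_surjective Q hQ0 hQs hk Z
  refine ⟨skewField Y', skewField_conjTranspose Y', funext fun c => ?_⟩
  have h1 : Q k (skewField Y') c = (2⁻¹ : ℂ) • Q k (fun b => Y' b - (Y' b)ᴴ) c :=
    linFamily_const_smul Q hQ0 hQs (2⁻¹ : ℂ) k (fun b => Y' b - (Y' b)ᴴ) c
  rw [h1, iterQ_sub_conjTranspose Q hQ0 hQs k Y' c, hY', hZ c, sub_neg_eq_add, ← two_smul ℂ (Z c), smul_smul,
    inv_mul_cancel₀ two_ne_zero, one_smul]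

variable [NeZero N]

/-- ★ **AT THE FLAT BACKGROUND def-Y's REAL-FORM OPERATOR IS `L^{-k}·Q_k(1)`**: `qSkewOp k 1 Y = (L^k)⁻¹ • dIterL k 1 Y` for EVERY matrix field `Y`
(`↑1 = 1`, `Y·1 = Y`, `Ū^k(1) = 1` by n07-w1's `iterM_apply_one`, `1⋆ = 1`). [cite: Balaban1985Variational, (44),(47) p.285; Balaban1985BackgroundPropagators, (3.13) p.393] -/
theorem qSkewOp_one_apply (k : ℕ) (Y : PBond P 0 → Matrix (Fin N) (Fin N) ℂ) (c : PBond P k) :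
    qSkewOp k (1 : GaugeField P 0 (SU N)) Y c = ((P.L : ℂ) ^ k)⁻¹ • dIterL k (1 : PBond P 0 → Matrix (Fin N) (Fin N) ℂ) Y c := by
  have hv : (fun b => Y b * (((1 : GaugeField P 0 (SU N)) b : SU N) : Matrix (Fin N) (Fin N) ℂ)) = Y := funext fun _ => mul_one _
  rw [qSkewOp_apply, coeField_one, hv, iterM_apply_one, Pi.one_apply, star_one, mul_one]

include hQ0 hQs in
/-- ★★ **EVERY SKEW LEVEL-`k` FIELD IS `qSkewOp k 1` OF A SKEW FINE FIELD** (`k ≤ m + K`): take the skew `Q^{(k)}`-preimage of `L^k·Z` (`exists_skew_linFamily_eq`) and read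
`Q_k(1) = Q^{(k)}` on skew fields (n07-w1's ★★★ `dIterL_one_apply_of_skew`). [cite: Balaban1985Variational, (44)-(47) p.285; Balaban1985Averaging, Prop. 3 (124)-(125) p.36] -/
theorem exists_skew_qSkewOp_one_eq {k : ℕ} (hk : k ≤ P.m + P.K) {Z : PBond P k → Matrix (Fin N) (Fin N) ℂ} (hZ : ∀ c, (Z c)ᴴ = -Z c) :
    ∃ Y : PBond P 0 → Matrix (Fin N) (Fin N) ℂ, (∀ b, (Y b)ᴴ = -Y b) ∧ qSkewOp k (1 : GaugeField P 0 (SU N)) Y = Z := by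
  have hL : ((P.L : ℂ) ^ k) ≠ 0 := pow_ne_zero _ (Nat.cast_ne_zero.mpr P.L_pos.ne')
  have hZ' : ∀ c, (((P.L : ℂ) ^ k) • Z c)ᴴ = -(((P.L : ℂ) ^ k) • Z c) := fun c => by
    rw [Matrix.conjTranspose_smul, hZ c, smul_neg, star_pow, star_natCast]
  obtain ⟨Y, hY, hQY⟩ := exists_skew_linFamily_eq Q hQ0 hQs hk (Z := fun c => ((P.L : ℂ) ^ k) • Z c) hZ'
  have hYs : ∀ b, star (Y b) = -Y b := fun b => by
    rw [Matrix.star_eq_conjTranspose]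
    exact hY b
  refine ⟨Y, hY, funext fun c => ?_⟩
  have hc : Q k Y c = ((P.L : ℂ) ^ k) • Z c := congrFun hQY c
  rw [qSkewOp_one_apply, (dIterL_one_apply_of_skew Q hQ0 hQs hYs k).1, hc, smul_smul, inv_mul_cancel₀ hL, one_smul]

/-- ★★★ **PRINT'S `Q_k(1)` ON `𝔤ᶜ`-VALUED FIELDS (def-Y's `qCplxOp k 1`) IS ONTO, `k ≤ m + K`** (§1 at `T := qSkewOp k 1` + `exists_skew_qSkewOp_one_eq` for UST's
recursion family `ChartHInv.exists_linFamily`). [cite: Balaban1985Variational, (45) p.285; Balaban1985BackgroundPropagators, (3.13)-(3.15) p.393] -/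
theorem qCplxOp_one_surjective {k : ℕ} (hk : k ≤ P.m + P.K) :
    Function.Surjective (qCplxOp k (1 : GaugeField P 0 (SU N))) := by
  obtain ⟨Q, hQ0, hQs⟩ := exists_linFamily (P := P) (n := Fin N)
  show Function.Surjective (cplxOp (qSkewOp k (1 : GaugeField P 0 (SU N))))
  exact cplxOp_surjective_of_skew _ fun Z hZ => exists_skew_qSkewOp_one_eq Q hQ0 hQs hk hZ

end Lattice

/-! ## §3  At the record: the read-in∕read-out are equivalences; `QOfRecord F N k 1` is onto -/

section Record

variable (F : T4Family) (N : ℕ) (K k : ℕ)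

/-- ★ The READ-IN `bondFieldIn` (lit bond carrier → matrix fields on the record's bonds) is onto: it is evaluation through the equivalences `WL2.equiv`, `bondToLit`,
`phiRec`. [cite: Balaban1985BackgroundPropagators, (3.11) p.392 (bookkeeping)] -/
theorem bondFieldIn_surjective : Function.Surjective (bondFieldIn F N (K := K) k) := by
  intro X
  refine ⟨(WL2.equiv ℂ _ _).symm fun a => (phiRec N).symm (X ((bondToLit (F.P K) 0).symm a)), funext fun b => ?_⟩
  rw [bondFieldIn_apply, Equiv.apply_symm_apply]
  show phiRec N ((phiRec N).symm (X ((bondToLit (F.P K) 0).symm (bondToLit (F.P K) 0 b)))) = X b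
  rw [Equiv.symm_apply_apply, LinearEquiv.apply_symm_apply]

/-- ★ The READ-OUT `bondFieldOut` (matrix fields on level-`k` bonds → the weighted carrier of (3.16)) is onto: it is `(phiRec N).symm` bondwise through `WL2.equiv`.
[cite: Balaban1985BackgroundPropagators, (3.16) p.393 (bookkeeping)] -/
theorem bondFieldOut_surjective : Function.Surjective (bondFieldOut F N (K := K) k) := by
  intro G
  refine ⟨fun c => phiRec N (WL2.equiv ℂ _ _ G c), (WL2.equiv ℂ (wBRec F K k) (WRec N)).injective (funext fun c => ?_)⟩
  simp only [bondFieldOut_apply, LinearEquiv.symm_apply_apply]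

/-- ★★ **ANY BACKGROUND: `QOfRecord F N k U₀` IS ONTO AS SOON AS `qCplxOp k U₀` IS** (`QOfRecord = bondFieldOut ∘ qCplxOp ∘ bondFieldIn`, the outer two onto) — with §1
this reduces def-Y's displayed `hQ` at every `U₀` to «every skew level-`k` field is `qSkewOp k U₀` of a skew fine field».
[cite: Balaban1985BackgroundPropagators, (3.13)-(3.16) p.393; Balaban1985Variational, (45) p.285, (100) p.293] -/
theorem QOfRecord_surjective_of_qCplxOp (U₀ : GaugeField (F.P K) 0 (SU N)) (h : Function.Surjective (qCplxOp k U₀)) :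
    Function.Surjective (QOfRecord F N k U₀) := by
  show Function.Surjective (bondFieldOut F N k ∘ₗ qCplxOp k U₀ ∘ₗ bondFieldIn F N k)
  rw [LinearMap.coe_comp, LinearMap.coe_comp]
  exact (bondFieldOut_surjective F N K k).comp (h.comp (bondFieldIn_surjective F N K k))

/-- ★★ **ANY BACKGROUND, REAL-FORM CRITERION: `QOfRecord F N k U₀` IS ONTO AS SOON AS EVERY SKEW-HERMITIAN LEVEL-`k` FIELD IS `qSkewOp k U₀` OF A SKEW-HERMITIAN
FINE FIELD** (§1 `cplxOp_surjective_of_skew` at `T := qSkewOp k U₀` + `QOfRecord_surjective_of_qCplxOp`) — the entry point for the guarded small-field background (dag-n07-e's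
corrector ∕ phase-equivariance road, bus CLAIM-2 2026-08-31). [cite: Balaban1985BackgroundPropagators, (3.13)-(3.16) p.393; Balaban1985Variational, (45) p.285] -/
theorem QOfRecord_surjective_of_skew (U₀ : GaugeField (F.P K) 0 (SU N))
    (h : ∀ Z : PBond (F.P K) k → Matrix (Fin N) (Fin N) ℂ, (∀ c, (Z c)ᴴ = -Z c) →
      ∃ Y : PBond (F.P K) 0 → Matrix (Fin N) (Fin N) ℂ, (∀ b, (Y b)ᴴ = -Y b) ∧ qSkewOp k U₀ Y = Z) :
    Function.Surjective (QOfRecord F N k U₀) := by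
  refine QOfRecord_surjective_of_qCplxOp F N K k U₀ ?_
  show Function.Surjective (cplxOp (qSkewOp k U₀))
  exact cplxOp_surjective_of_skew (qSkewOp k U₀) h

/-- ★★★ **THE RECORD'S `Q = Q_k(1)` IS ONTO AT THE FLAT BACKGROUND** (`k ≤ m + K`): `Function.Surjective (QOfRecord F N k 1)` — the displayed hypothesis `hQ` of
`Node00.frakGOfRecordAtBg F N K k Ω U₀ a hpos hQ` ∕ `Node00.H1OfRecordAtBg` DISCHARGED at `U₀ = 1` (so that there `QG₁Q*` of [Balaban1985Variational] (103)∕(111) is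
invertible).  The guarded small background of record is NOT covered (HONEST SCOPE). [cite: Balaban1985Variational, (45) p.285, (103) p.293, (111) p.294, (116)-(117) p.295; Balaban1985BackgroundPropagators, (3.13)-(3.16) p.393] -/
theorem QOfRecord_one_surjective [NeZero N] (hk : k ≤ F.m + K) :
    Function.Surjective (QOfRecord F N k (1 : GaugeField (F.P K) 0 (SU N))) :=
  QOfRecord_surjective_of_qCplxOp F N K k 1 (qCplxOp_one_surjective (P := F.P K) hk)

end Record

end Summit.QuantumFields.YangMills.Theorems.N07QOfRecordFlatOnto

end
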